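import Mathlib
import Summits.NavierStokesRegularity.NavierStokesRegularity.Theorems.EulerZoomLiouvillePowerGaugeEulerLiouvilleClassIsometry
import HarnessLib

/-!
# Crux E `PowerGaugeEulerLiouville` (stmt-NavierStokesRegularity-19832): the GENERIC CONJUGATION LEMMA for GENERAL class members
# (no self-similar ansatz) — any member-level stratum can sit under one `∃ R` (width seat ns-ezl-w1 g10; KEY W1-AX2 (a) of the LEAD ns-typeII-p2 g16)

Route №10 `EulerZoomLiouville` (NavierStokesRegularity), crux E.  Seregin's class is `O(3)`-invariant (ns-ezl-w2 g3 `…ClassIsometry`, p642230: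
`isSuitableWeakSolutionOn_conj_isometry`, `hasWeakSpatialGradientOn_conj_isometry`, `gauge_conj_isometry`; distributional half ns-ezl-w3 g3
`…PressureSlavingIsometry`).  The two existing transports `ClassIsometry.selfSimilar_ae_eq_zero_of_conj` (ns-ezl-w3 g3, p643199) and
`ClassIsometry.pastSelfSimilar_ae_eq_zero_of_conj` carry an exactly-self-similar ansatz; this file records the ansatz-free form:

* `ClassIsometry.ae_eq_zero_of_conj` — a member `(u, p, H)` of the class (suitable weak Euler on `(−∞,0) × ℝ³`, weak spatial gradient `H`, power
  gauges with exponent `ρ` bounded by `c`) is trivial as soon as EVERY triple `(u′, p′, H′)` satisfying the same three binders with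
  `u′ = (τ, x) ↦ R u(τ, R⁻¹ x)` and `p′ = (τ, x) ↦ p(τ, R⁻¹ x)` is a.e. zero on the past slab (`R` any linear isometry of `ℝ³`).

With it the LEAD puts one `∃ R` around any MEMBER-level stratum of `stub_nonSelfSimilarRest` (classical, slab-bounded, Lagrangian, …):
`(∃ R, Stratum (conj_R u) (conj_R p)) ⇒ u = 0 a.e.` by `obtain ⟨R, h⟩; exact ae_eq_zero_of_conj … R (fun u' p' H' hsw' hH' hg' hu' hp' => by subst hu' hp'; exact filler … h)`.

WHAT THIS IS NOT: not NS regularity, not the crux E — by-name transport for strata of the crux CLASS 19832; 19832 OPEN.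
[folklore; MajdaBertozziCUP2002 §1.2 Prop. 1.1 (iii); CaffarelliKohnNirenberg1982 §2]
-/

noncomputable section

-- flat `Theorems/<Route><Decl>…` files of one crux share the namespace of the crux (tree convention: `Summit.<S>.<S>.…`)
set_option linter.dupNamespace false

open MeasureTheory Set Filter Topology Metric Function
open scoped NNReal ENNReal

namespace Summit.NavierStokesRegularity.NavierStokesRegularity.Theorems.PowerGaugeEulerLiouville

open Literature.Analysis Literature.Analysis.FluidPDE

namespace ClassIsometry

variable {u : ℝ → EuclideanSpace ℝ (Fin 3) → EuclideanSpace ℝ (Fin 3)} {p : ℝ → EuclideanSpace ℝ (Fin 3) → ℝ}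
  {H : ℝ → EuclideanSpace ℝ (Fin 3) → EuclideanSpace ℝ (Fin 3) →L[ℝ] EuclideanSpace ℝ (Fin 3)} {c : ℝ≥0∞}

/-- **GENERIC CONJUGATION LEMMA FOR CLASS MEMBERS (no ansatz).**  Crux binders verbatim (suitable weak Euler on `(−∞,0) × ℝ³`, weak spatial
gradient `H`, gauges with exponent `ρ` bounded by `c` at every scale); `R` a linear isometry of `ℝ³`.  If EVERY triple `(u′, p′, H′)` satisfying the
same three binders with `u′ = (τ, x) ↦ R u(τ, R⁻¹ x)` and `p′ = (τ, x) ↦ p(τ, R⁻¹ x)` is a.e. zero on the past slab, then so is `u` (apply the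
hypothesis to the conjugated member — `isSuitableWeakSolutionOn_conj_isometry` / `hasWeakSpatialGradientOn_conj_isometry` / `gauge_conj_isometry` —
and pull the vanishing back along the measure-preserving `(s, x) ↦ (s, R x)`). [folklore; MajdaBertozziCUP2002 §1.2 Prop. 1.1 (iii)] -/
theorem ae_eq_zero_of_conj {ρ : ℝ}
    (hsw : IsSuitableWeakSolutionOn (slab (EuclideanSpace ℝ (Fin 3)) (Iio 0) isOpen_Iio) 0 0 u p)
    (hH : HasWeakSpatialGradientOn (slab (EuclideanSpace ℝ (Fin 3)) (Iio 0) isOpen_Iio) u H)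
    (hgauge : ∀ a : ℝ, 0 < a →
      ENNReal.ofReal (a ^ (2 * ρ)) * cknA a (0 : ℝ × EuclideanSpace ℝ (Fin 3)) u +
          ENNReal.ofReal (a ^ ρ) * cknE a (0 : ℝ × EuclideanSpace ℝ (Fin 3)) H +
        ENNReal.ofReal (a ^ (2 * ρ)) * cknD a (0 : ℝ × EuclideanSpace ℝ (Fin 3)) p ≤ c)
    (R : EuclideanSpace ℝ (Fin 3) ≃ₗᵢ[ℝ] EuclideanSpace ℝ (Fin 3))
    (hkill : ∀ (u' : ℝ → EuclideanSpace ℝ (Fin 3) → EuclideanSpace ℝ (Fin 3)) (p' : ℝ → EuclideanSpace ℝ (Fin 3) → ℝ)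
        (H' : ℝ → EuclideanSpace ℝ (Fin 3) → EuclideanSpace ℝ (Fin 3) →L[ℝ] EuclideanSpace ℝ (Fin 3)),
      IsSuitableWeakSolutionOn (slab (EuclideanSpace ℝ (Fin 3)) (Iio 0) isOpen_Iio) 0 0 u' p' →
      HasWeakSpatialGradientOn (slab (EuclideanSpace ℝ (Fin 3)) (Iio 0) isOpen_Iio) u' H' →
      (∀ a : ℝ, 0 < a →
        ENNReal.ofReal (a ^ (2 * ρ)) * cknA a (0 : ℝ × EuclideanSpace ℝ (Fin 3)) u' +
            ENNReal.ofReal (a ^ ρ) * cknE a (0 : ℝ × EuclideanSpace ℝ (Fin 3)) H' +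
          ENNReal.ofReal (a ^ (2 * ρ)) * cknD a (0 : ℝ × EuclideanSpace ℝ (Fin 3)) p' ≤ c) →
      u' = (fun τ x => R (u τ (R.symm x))) →
      p' = (fun τ x => p τ (R.symm x)) →
      uncurry u' =ᵐ[volume.restrict (Iio (0 : ℝ) ×ˢ (univ : Set (EuclideanSpace ℝ (Fin 3))))] 0) :
    uncurry u =ᵐ[volume.restrict (Iio (0 : ℝ) ×ˢ (univ : Set (EuclideanSpace ℝ (Fin 3))))] 0 := by
  -- adapted from ns-ezl-w3 g3's `ClassIsometry.selfSimilar_ae_eq_zero_of_conj` (p643199), minus the ansatz clauses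
  -- the conjugated member
  have hsw' := isSuitableWeakSolutionOn_conj_isometry isOpen_Iio hsw R
  have hf0 : (fun (s : ℝ) (x : EuclideanSpace ℝ (Fin 3)) =>
      R ((0 : ℝ → EuclideanSpace ℝ (Fin 3) → EuclideanSpace ℝ (Fin 3)) s (R.symm x))) = 0 := by
    funext s x
    simp
  rw [hf0] at hsw'
  have hH' := hasWeakSpatialGradientOn_conj_isometry isOpen_Iio hH R
  have hgauge' := gauge_conj_isometry R hgauge
  have h' := hkill _ _ _ hsw' hH' hgauge' rfl rfl
  -- pull the vanishing back along `(s, x) ↦ (s, R x)`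
  set Ψ : ℝ × EuclideanSpace ℝ (Fin 3) → ℝ × EuclideanSpace ℝ (Fin 3) := fun z => (z.1, R z.2) with hΨ
  have hΨmp : MeasurePreserving Ψ
      (volume.restrict (Iio (0 : ℝ) ×ˢ (univ : Set (EuclideanSpace ℝ (Fin 3)))))
      (volume.restrict (Iio (0 : ℝ) ×ˢ (univ : Set (EuclideanSpace ℝ (Fin 3))))) := by
    have h1 := (PressureSlaving.measurePreserving_prod_isometry R).restrict_preimage_emb
      (PressureSlaving.measurableEmbedding_prod_isometry R) (Iio (0 : ℝ) ×ˢ (univ : Set (EuclideanSpace ℝ (Fin 3))))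
    rwa [PressureSlaving.preimage_prod_isometry_slab] at h1
  have h2 : ∀ᵐ z ∂(volume.restrict (Iio (0 : ℝ) ×ˢ (univ : Set (EuclideanSpace ℝ (Fin 3))))),
      uncurry (fun s x => R (u s (R.symm x))) (Ψ z) = (0 : ℝ × EuclideanSpace ℝ (Fin 3) → EuclideanSpace ℝ (Fin 3)) (Ψ z) :=
    hΨmp.quasiMeasurePreserving.tendsto_ae.eventually h'
  filter_upwards [h2] with z hz
  have hz' : R (u z.1 z.2) = 0 := by simpa [hΨ, uncurry] using hz
  show u z.1 z.2 = 0
  simpa using hz'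

end ClassIsometry

end Summit.NavierStokesRegularity.NavierStokesRegularity.Theorems.PowerGaugeEulerLiouville

end
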